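import Summits.CriticalPhenomena.PercolationContinuityZ3.Theorems.PercAnnulusCrossingIICGluedAnnuliDensity
import HarnessLib

/-!
# Glued annuli: the sharp density `c − ε` (Chernoff with a free weight) (lane RSW3, p1 gen 18)

builds on p205010 (kernel theorem, internal audit signed; external expert review pending) — NOT used in this file.

RSW3 lane (LANE 3 `prim-rsw3`), seat `prim-rsw3-p1` (gen 18).  Helper file (`--supports stmt-CriticalPhenomena-4575`);
no definitions, no sorries.  Memo `run/shared/lean/prim/rsw3/P1-QM.md` §31.9.

`…IICGluedAnnuliDensity` ran the level-set moment-generating-function recursion with the fixed weight `1/2` and obtained density `≥ c/2`.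
With a free weight `t ∈ (0,1]` the same recursion gives the full Chernoff lower tail of an adapted count and the sharp density:

* `sum_pow_mul_measureReal_level_succ_le_of_weight`, `sum_pow_mul_measureReal_level_le_pow_of_weight`,
  **`measureReal_count_le_of_weight`** (any finite measure space; events `U_i`, `N_j = Σ_{i<j} 1_{U_i}`, level-wise bound
  `c·ν(N_j = v) ≤ ν({N_j = v} ∩ U_j)`): **`ν(N_k ≤ m) ≤ t^{−m} (1 − (1−t)c)^k ν(Ω)`** for every `t ∈ (0,1]`;
* **`iicMeasure_real_count_annulusUniq_le_of_weight`** — under `CU⁺_l(c)` and Kesten's IIC limit property: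
  `ν(#{i<k : U(a_i, la_i)} ≤ m) ≤ t^{−m} (1 − (1−t)c)^k`;
* **`iicMeasure_ae_eventually_count_annulusUniq_gt_of_lt`** — for every `δ < c`: **`ν`-a.s. eventually `#{i<k : U(a_i, la_i)} > δk`**
  (weight `t = (1 + δ/c)/2`: `log(t^{−δ}(1 − (1−t)c)) ≤ (1−t)(δ/t − c) < 0`): THE GLUED SCALES HAVE LOWER DENSITY AT LEAST `c`.
References: H. Kesten, PTRF 73 (1986) §2; standard Chernoff bound for sums dominating a binomial.
-/

noncomputable section

namespace Summit.CriticalPhenomena.PercolationContinuityZ3.Theorems.Crossing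

open MeasureTheory Filter Topology Literature.Probability.Percolation Literature.Probability.LatticeModels
open Literature.Probability.Percolation.DCT16
open Summit.CriticalPhenomena.PercolationContinuityZ3.Theorems.SurfaceTension

section Generic

variable {Ω : Type*} [MeasurableSpace Ω]

/-- **MGF recursion on level sets, free weight `t ∈ (0,1]`**: if `c·ν(N_j = v) ≤ ν({N_j = v} ∩ U_j)` for every `v`, then
`Σ_{v<K} t^v ν(N_{j+1} = v) ≤ (1 − (1−t)c) Σ_{v<K} t^v ν(N_j = v)`. [folklore] -/
theorem sum_pow_mul_measureReal_level_succ_le_of_weight {ν : Measure Ω} [IsFiniteMeasure ν] (U : ℕ → Set Ω)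
    (hU : ∀ i, MeasurableSet (U i)) {t : ℝ} (ht0 : 0 ≤ t) (ht1 : t ≤ 1) {c : ℝ} (j : ℕ)
    (hcond : ∀ v : ℕ, c * ν.real {ω | ∑ i ∈ Finset.range j, (U i).indicator (fun _ => (1 : ℕ)) ω = v} ≤
      ν.real ({ω | ∑ i ∈ Finset.range j, (U i).indicator (fun _ => (1 : ℕ)) ω = v} ∩ U j)) (K : ℕ) :
    ∑ v ∈ Finset.range K, t ^ v * ν.real {ω | ∑ i ∈ Finset.range (j + 1), (U i).indicator (fun _ => (1 : ℕ)) ω = v} ≤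
      (1 - (1 - t) * c) * ∑ v ∈ Finset.range K, t ^ v *
        ν.real {ω | ∑ i ∈ Finset.range j, (U i).indicator (fun _ => (1 : ℕ)) ω = v} := by
  set N : Ω → ℕ := fun ω => ∑ i ∈ Finset.range j, (U i).indicator (fun _ => (1 : ℕ)) ω with hN
  have hsucc : ∀ ω, ∑ i ∈ Finset.range (j + 1), (U i).indicator (fun _ => (1 : ℕ)) ω = N ω + (U j).indicator (fun _ => 1) ω :=
    fun ω => Finset.sum_range_succ _ _
  have hin : ∀ v : ℕ, ({ω | ∑ i ∈ Finset.range (j + 1), (U i).indicator (fun _ => (1 : ℕ)) ω = v} ∩ U j : Set Ω) =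
      {ω | N ω + 1 = v} ∩ U j := by
    intro v; ext ω; simp only [Set.mem_inter_iff, Set.mem_setOf_eq, hsucc]
    exact ⟨fun ⟨h1, h2⟩ => ⟨by rwa [Set.indicator_of_mem h2] at h1, h2⟩, fun ⟨h1, h2⟩ => ⟨by rwa [Set.indicator_of_mem h2], h2⟩⟩
  have hout : ∀ v : ℕ, ({ω | ∑ i ∈ Finset.range (j + 1), (U i).indicator (fun _ => (1 : ℕ)) ω = v} \ U j : Set Ω) =
      {ω | N ω = v} \ U j := by
    intro v; ext ω; simp only [Set.mem_sdiff, Set.mem_setOf_eq, hsucc]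
    exact ⟨fun ⟨h1, h2⟩ => ⟨by rwa [Set.indicator_of_notMem h2, add_zero] at h1, h2⟩,
      fun ⟨h1, h2⟩ => ⟨by rwa [Set.indicator_of_notMem h2, add_zero], h2⟩⟩
  have hsplit : ∀ v : ℕ, ν.real {ω | ∑ i ∈ Finset.range (j + 1), (U i).indicator (fun _ => (1 : ℕ)) ω = v} =
      (ν.real {ω | N ω = v} - ν.real ({ω | N ω = v} ∩ U j)) + ν.real ({ω | N ω + 1 = v} ∩ U j) := by
    intro v
    have h1 := measureReal_inter_add_sdiff (μ := ν)
      (s := ({ω | ∑ i ∈ Finset.range (j + 1), (U i).indicator (fun _ => (1 : ℕ)) ω = v} : Set Ω)) (hU j)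
    have h2 := measureReal_inter_add_sdiff (μ := ν) (s := ({ω | N ω = v} : Set Ω)) (hU j)
    rw [hin, hout] at h1
    linarith
  -- the shifted sum is `t` times the `U j`-sum
  have hshift : ∑ v ∈ Finset.range K, t ^ v * ν.real ({ω | N ω + 1 = v} ∩ U j) ≤
      t * ∑ v ∈ Finset.range K, t ^ v * ν.real ({ω | N ω = v} ∩ U j) := by
    cases K with
    | zero => simp
    | succ K =>
      rw [Finset.sum_range_succ' (fun v => t ^ v * ν.real ({ω | N ω + 1 = v} ∩ U j))]
      have h0 : ({ω | N ω + 1 = 0} ∩ U j : Set Ω) = ∅ := by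
        ext ω; simp
      have hterm : ∀ v : ℕ, t ^ (v + 1) * ν.real ({ω | N ω + 1 = v + 1} ∩ U j) =
          t * (t ^ v * ν.real ({ω | N ω = v} ∩ U j)) := by
        intro v
        have : ({ω | N ω + 1 = v + 1} ∩ U j : Set Ω) = {ω | N ω = v} ∩ U j := by
          ext ω; simp
        rw [this, pow_succ]; ring
      simp only [hterm, h0, measureReal_empty, mul_zero, add_zero, ← Finset.mul_sum]
      rw [Finset.sum_range_succ]
      have hnn : 0 ≤ t ^ K * ν.real ({ω | N ω = K} ∩ U j) := by positivity
      nlinarith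
  have hcondsum : c * ∑ v ∈ Finset.range K, t ^ v * ν.real {ω | N ω = v} ≤
      ∑ v ∈ Finset.range K, t ^ v * ν.real ({ω | N ω = v} ∩ U j) := by
    rw [Finset.mul_sum]
    refine Finset.sum_le_sum fun v _ => ?_
    calc c * (t ^ v * ν.real {ω | N ω = v}) = t ^ v * (c * ν.real {ω | N ω = v}) := by ring
      _ ≤ t ^ v * ν.real ({ω | N ω = v} ∩ U j) := mul_le_mul_of_nonneg_left (hcond v) (by positivity)
  have hSle : ∑ v ∈ Finset.range K, t ^ v * ν.real ({ω | N ω = v} ∩ U j) ≤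
      ∑ v ∈ Finset.range K, t ^ v * ν.real {ω | N ω = v} :=
    Finset.sum_le_sum fun v _ => mul_le_mul_of_nonneg_left (measureReal_mono Set.inter_subset_left (measure_ne_top _ _))
      (by positivity)
  have heq : ∑ v ∈ Finset.range K, t ^ v *
        ν.real {ω | ∑ i ∈ Finset.range (j + 1), (U i).indicator (fun _ => (1 : ℕ)) ω = v} =
      ∑ v ∈ Finset.range K, t ^ v * ν.real {ω | N ω = v} -
        ∑ v ∈ Finset.range K, t ^ v * ν.real ({ω | N ω = v} ∩ U j) +
        ∑ v ∈ Finset.range K, t ^ v * ν.real ({ω | N ω + 1 = v} ∩ U j) := by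
    rw [← Finset.sum_sub_distrib, ← Finset.sum_add_distrib]
    exact Finset.sum_congr rfl fun v _ => by rw [hsplit v]; ring
  rw [heq]
  -- `M − S + T ≤ M − (1−t) S ≤ M − (1−t) c M` (uses `S ≤ M` when `c` is negative-free: we only need `(1−t) ≥ 0`)
  have h1t : 0 ≤ 1 - t := by linarith
  nlinarith [hshift, hcondsum, hSle, h1t, mul_le_mul_of_nonneg_left hcondsum h1t]

/-- **`Σ_v t^v ν(N_k = v) ≤ (1 − (1−t)c)^k ν(Ω)`** under the level-wise conditional bound at every step (`t ∈ (0,1]`, `c ≤ 1`). [folklore] -/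
theorem sum_pow_mul_measureReal_level_le_pow_of_weight {ν : Measure Ω} [IsFiniteMeasure ν] (U : ℕ → Set Ω)
    (hU : ∀ i, MeasurableSet (U i)) {t : ℝ} (ht0 : 0 ≤ t) (ht1 : t ≤ 1) {c : ℝ} (hc : c ≤ 1)
    (hcond : ∀ j v : ℕ, c * ν.real {ω | ∑ i ∈ Finset.range j, (U i).indicator (fun _ => (1 : ℕ)) ω = v} ≤
      ν.real ({ω | ∑ i ∈ Finset.range j, (U i).indicator (fun _ => (1 : ℕ)) ω = v} ∩ U j)) (k K : ℕ) :
    ∑ v ∈ Finset.range K, t ^ v * ν.real {ω | ∑ i ∈ Finset.range k, (U i).indicator (fun _ => (1 : ℕ)) ω = v} ≤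
      (1 - (1 - t) * c) ^ k * ν.real Set.univ := by
  have h1c : 0 ≤ 1 - (1 - t) * c := by nlinarith
  induction k with
  | zero =>
    rw [pow_zero, one_mul]
    calc ∑ v ∈ Finset.range K, t ^ v * ν.real {ω | ∑ i ∈ Finset.range 0, (U i).indicator (fun _ => (1 : ℕ)) ω = v}
        = ∑ v ∈ Finset.range K, (if v = 0 then ν.real (Set.univ : Set Ω) else 0) := by
          refine Finset.sum_congr rfl fun v _ => ?_
          rcases Nat.eq_zero_or_pos v with rfl | hv
          · simp
          · rw [if_neg hv.ne']
            have : ({ω | ∑ i ∈ Finset.range 0, (U i).indicator (fun _ => (1 : ℕ)) ω = v} : Set Ω) = ∅ := by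
              ext ω; simp only [Finset.range_zero, Finset.sum_empty, Set.mem_setOf_eq, Set.mem_empty_iff_false, iff_false]
              omega
            rw [this, measureReal_empty, mul_zero]
      _ ≤ ν.real Set.univ := by
          rw [Finset.sum_ite_eq']
          split_ifs
          · exact le_rfl
          · exact measureReal_nonneg
  | succ k ih =>
    calc _ ≤ (1 - (1 - t) * c) * ∑ v ∈ Finset.range K, t ^ v *
          ν.real {ω | ∑ i ∈ Finset.range k, (U i).indicator (fun _ => (1 : ℕ)) ω = v} :=
          sum_pow_mul_measureReal_level_succ_le_of_weight U hU ht0 ht1 k (hcond k) K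
      _ ≤ (1 - (1 - t) * c) * ((1 - (1 - t) * c) ^ k * ν.real Set.univ) := mul_le_mul_of_nonneg_left ih h1c
      _ = (1 - (1 - t) * c) ^ (k + 1) * ν.real Set.univ := by ring

/-- **CHERNOFF LOWER TAIL OF AN ADAPTED COUNT, free weight**: `ν(N_k ≤ m) ≤ t^{−m} (1 − (1−t)c)^k ν(Ω)` for every `t ∈ (0,1]` (`c ≤ 1`),
whenever each `U_j` has conditional probability `≥ c` given every level set of `N_j`. [folklore] -/
theorem measureReal_count_le_of_weight {ν : Measure Ω} [IsFiniteMeasure ν] (U : ℕ → Set Ω)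
    (hU : ∀ i, MeasurableSet (U i)) {t : ℝ} (ht0 : 0 < t) (ht1 : t ≤ 1) {c : ℝ} (hc : c ≤ 1)
    (hcond : ∀ j v : ℕ, c * ν.real {ω | ∑ i ∈ Finset.range j, (U i).indicator (fun _ => (1 : ℕ)) ω = v} ≤
      ν.real ({ω | ∑ i ∈ Finset.range j, (U i).indicator (fun _ => (1 : ℕ)) ω = v} ∩ U j)) (k m : ℕ) :
    ν.real {ω | ∑ i ∈ Finset.range k, (U i).indicator (fun _ => (1 : ℕ)) ω ≤ m} ≤
      t⁻¹ ^ m * (1 - (1 - t) * c) ^ k * ν.real Set.univ := by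
  set N : Ω → ℕ := fun ω => ∑ i ∈ Finset.range k, (U i).indicator (fun _ => (1 : ℕ)) ω with hN
  have hsub : ({ω | N ω ≤ m} : Set Ω) ⊆ ⋃ v ∈ Finset.range (m + 1), {ω | N ω = v} := by
    intro ω hω
    exact Set.mem_biUnion (Finset.mem_coe.2 (Finset.mem_range.2 (Nat.lt_succ_of_le hω))) rfl
  have hw : ∀ v ∈ Finset.range (m + 1), ν.real {ω | N ω = v} ≤ t⁻¹ ^ m * (t ^ v * ν.real {ω | N ω = v}) := by
    intro v hv
    have hvm : v ≤ m := Nat.lt_succ_iff.1 (Finset.mem_range.1 hv)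
    have h1 : (1 : ℝ) ≤ t⁻¹ ^ m * t ^ v := by
      have hti : 1 ≤ t⁻¹ := (one_le_inv₀ ht0).2 ht1
      have h2 : t⁻¹ ^ v ≤ t⁻¹ ^ m := pow_le_pow_right₀ hti hvm
      have h3 : t⁻¹ ^ v * t ^ v = 1 := by rw [← mul_pow, inv_mul_cancel₀ ht0.ne', one_pow]
      nlinarith [pow_nonneg ht0.le v]
    nlinarith [measureReal_nonneg (μ := ν) (s := {ω | N ω = v})]
  calc ν.real {ω | N ω ≤ m} ≤ ν.real (⋃ v ∈ Finset.range (m + 1), {ω | N ω = v}) := measureReal_mono hsub (measure_ne_top ν _)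
    _ ≤ ∑ v ∈ Finset.range (m + 1), ν.real {ω | N ω = v} := measureReal_biUnion_finset_le _ _
    _ ≤ ∑ v ∈ Finset.range (m + 1), t⁻¹ ^ m * (t ^ v * ν.real {ω | N ω = v}) := Finset.sum_le_sum hw
    _ = t⁻¹ ^ m * ∑ v ∈ Finset.range (m + 1), t ^ v * ν.real {ω | N ω = v} := by rw [Finset.mul_sum]
    _ ≤ t⁻¹ ^ m * ((1 - (1 - t) * c) ^ k * ν.real Set.univ) :=
        mul_le_mul_of_nonneg_left (sum_pow_mul_measureReal_level_le_pow_of_weight U hU ht0.le ht1 hc hcond k (m + 1))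
          (by positivity)
    _ = t⁻¹ ^ m * (1 - (1 - t) * c) ^ k * ν.real Set.univ := by ring

end Generic

variable {d : ℕ}

/-- **GLUED ANNULI, CHERNOFF LOWER TAIL WITH A FREE WEIGHT**: under `CU⁺_l(c)` and Kesten's IIC limit property (every `d`, `p`; nested scales),
**`ν(#{i<k : U(a_i, la_i)} ≤ m) ≤ t^{−m} (1 − (1−t)c)^k`** for every `t ∈ (0,1]`. [cite: Kesten1986, §2] -/
theorem iicMeasure_real_count_annulusUniq_le_of_weight (p : unitInterval) {l : ℕ} (hl : 2 ≤ l) {c : ℝ}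
    (hCU : ∀ a : ℕ, 1 ≤ a → ∀ E : Set (BondConfig (Site d)), IsUpperSet E → MeasurableSet E →
      c * (bondPercolation (zdGraph d) p).real E ≤ (bondPercolation (zdGraph d) p).real (E ∩
        {ω : BondConfig (Site d) | ∀ t ∈ innerBoundary (zdGraph d) (box d a), ∀ s ∈ innerBoundary (zdGraph d) (box d (l * a)),
        ∀ t' ∈ innerBoundary (zdGraph d) (box d a), ∀ s' ∈ innerBoundary (zdGraph d) (box d (l * a)),
        ω ∈ openConnIn (↑((box d (l * a) \ box d a) ∪ innerBoundary (zdGraph d) (box d a)) : Set (Site d)) t s →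
        ω ∈ openConnIn (↑((box d (l * a) \ box d a) ∪ innerBoundary (zdGraph d) (box d a)) : Set (Site d)) t' s' →
        ω ∈ openConnIn (↑((box d (l * a) \ box d a) ∪ innerBoundary (zdGraph d) (box d a)) : Set (Site d)) s s'}))
    (a : ℕ → ℕ) (ha1 : ∀ i, 1 ≤ a i) (hnest : ∀ i, l * a i + 1 ≤ a (i + 1))
    {ν : Measure (BondConfig (Site d))} [IsProbabilityMeasure ν]
    (hν : ∀ (F : Finset (Sym2 (Site d))) (E : Set (BondConfig (Site d))), MeasurableSet E → DeterminedBy E ↑F →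
      Tendsto (fun n : ℕ => (bondPercolation (zdGraph d) p).real (E ∩ siteToBoundary d n) / oneArmProb d p n)
        atTop (𝓝 (ν.real E))) {t : ℝ} (ht0 : 0 < t) (ht1 : t ≤ 1) (k m : ℕ) :
    ν.real {ω | (∑ i ∈ Finset.range k, ({ω : BondConfig (Site d) | ∀ t ∈ innerBoundary (zdGraph d) (box d (a i)), ∀ s ∈ innerBoundary (zdGraph d) (box d (l * a i)),
        ∀ t' ∈ innerBoundary (zdGraph d) (box d (a i)), ∀ s' ∈ innerBoundary (zdGraph d) (box d (l * a i)),
        ω ∈ openConnIn (↑((box d (l * a i) \ box d (a i)) ∪ innerBoundary (zdGraph d) (box d (a i))) : Set (Site d)) t s →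
        ω ∈ openConnIn (↑((box d (l * a i) \ box d (a i)) ∪ innerBoundary (zdGraph d) (box d (a i))) : Set (Site d)) t' s' →
        ω ∈ openConnIn (↑((box d (l * a i) \ box d (a i)) ∪ innerBoundary (zdGraph d) (box d (a i))) : Set (Site d)) s s'} : Set (BondConfig (Site d))).indicator (fun _ => (1 : ℕ)) ω) ≤ m} ≤ t⁻¹ ^ m * (1 - (1 - t) * c) ^ k := by
  set U : ℕ → Set (BondConfig (Site d)) := fun i => {ω : BondConfig (Site d) | ∀ t ∈ innerBoundary (zdGraph d) (box d (a i)), ∀ s ∈ innerBoundary (zdGraph d) (box d (l * a i)),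
        ∀ t' ∈ innerBoundary (zdGraph d) (box d (a i)), ∀ s' ∈ innerBoundary (zdGraph d) (box d (l * a i)),
        ω ∈ openConnIn (↑((box d (l * a i) \ box d (a i)) ∪ innerBoundary (zdGraph d) (box d (a i))) : Set (Site d)) t s →
        ω ∈ openConnIn (↑((box d (l * a i) \ box d (a i)) ∪ innerBoundary (zdGraph d) (box d (a i))) : Set (Site d)) t' s' →
        ω ∈ openConnIn (↑((box d (l * a i) \ box d (a i)) ∪ innerBoundary (zdGraph d) (box d (a i))) : Set (Site d)) s s'} with hUdef
  have hc1 : c ≤ 1 := by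
    have h := hCU 1 le_rfl Set.univ isUpperSet_univ MeasurableSet.univ
    rw [probReal_univ, mul_one, Set.univ_inter] at h
    exact h.trans measureReal_le_one
  have hamono : Monotone a := monotone_nat_of_le_succ fun i => by nlinarith [hnest i, ha1 i]
  have hla : ∀ i i', i < i' → l * a i + 1 ≤ a i' := fun i i' hii' => (hnest i).trans (hamono (Nat.succ_le_of_lt hii'))
  have hUm : ∀ i, MeasurableSet (U i) := fun i =>
    measurableSet_of_isLocalEvent_holds (isLocalEvent_annulusUniq (d := d) (by nlinarith [ha1 i]))
  have hUdet : ∀ j, ∀ i ∈ Finset.range j, DeterminedBy (U i) (↑((box d (a j - 1)).sym2) : Set (Sym2 (Site d))) := by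
    intro j i hi
    have hij : i < j := Finset.mem_range.1 hi
    have h1 : l * a i ≤ a j - 1 := by have := hla i j hij; omega
    exact (determinedBy_annulusUniq (a i) (l * a i) (sym2_annulus_subset_sym2_box (by nlinarith [ha1 i]))).mono
      (Finset.coe_subset.2 (Finset.sym2_mono (box_mono d h1)))
  have hcond : ∀ j v : ℕ, c * ν.real {ω | ∑ i ∈ Finset.range j, (U i).indicator (fun _ => (1 : ℕ)) ω = v} ≤
      ν.real ({ω | ∑ i ∈ Finset.range j, (U i).indicator (fun _ => (1 : ℕ)) ω = v} ∩ U j) := by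
    intro j v
    have hDdet : DeterminedBy ({ω | ∑ i ∈ Finset.range j, (U i).indicator (fun _ => (1 : ℕ)) ω = v} : Set (BondConfig (Site d)))
        (↑((box d (a j - 1)).sym2) : Set (Sym2 (Site d))) := by
      rw [determinedBy_iff]
      intro ω ω' hωω'
      have hsum : ∑ i ∈ Finset.range j, (U i).indicator (fun _ => (1 : ℕ)) ω = ∑ i ∈ Finset.range j, (U i).indicator (fun _ => (1 : ℕ)) ω' := by
        refine Finset.sum_congr rfl fun i hi => ?_
        have hiff : ω ∈ U i ↔ ω' ∈ U i := (determinedBy_iff _ _).1 (hUdet j i hi) ω ω' hωω'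
        by_cases hω : ω ∈ U i
        · rw [Set.indicator_of_mem hω, Set.indicator_of_mem (hiff.1 hω)]
        · rw [Set.indicator_of_notMem hω, Set.indicator_of_notMem (fun h => hω (hiff.2 h))]
      simp only [Set.mem_setOf_eq, hsum]
    have hDm : MeasurableSet ({ω | ∑ i ∈ Finset.range j, (U i).indicator (fun _ => (1 : ℕ)) ω = v} : Set (BondConfig (Site d))) := by
      have hNm : Measurable fun ω : BondConfig (Site d) => ∑ i ∈ Finset.range j, (U i).indicator (fun _ => (1 : ℕ)) ω :=
        Finset.measurable_sum _ fun i _ => measurable_const.indicator (hUm i)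
      exact hNm (measurableSet_singleton v)
    exact iicMeasure_real_inter_annulusUniq_ge p hl hCU hν (ha1 j) hDdet hDm
  have h := measureReal_count_le_of_weight U hUm ht0 ht1 hc1 hcond k m
  rw [probReal_univ, mul_one] at h
  exact h

/-- **THE GLUED SCALES HAVE LOWER DENSITY AT LEAST `c`** (hypotheses of `iicMeasure_real_count_annulusUniq_le_of_weight`): for every `δ < c`,
**`ν`-a.s., for all large `k`, `#{i<k : U(a_i, la_i)} > δ·k`.**  Weight `t = (1 + δ/c)/2 ∈ (δ/c, 1)`: with `ρ = t^{−δ}(1 − (1−t)c)`,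
`log ρ ≤ δ(1/t − 1) − (1−t)c = (1−t)(δ/t − c) < 0`; Borel–Cantelli. [cite: Kesten1986, §2] -/
theorem iicMeasure_ae_eventually_count_annulusUniq_gt_of_lt (p : unitInterval) {l : ℕ} (hl : 2 ≤ l) {c : ℝ}
    (hCU : ∀ a : ℕ, 1 ≤ a → ∀ E : Set (BondConfig (Site d)), IsUpperSet E → MeasurableSet E →
      c * (bondPercolation (zdGraph d) p).real E ≤ (bondPercolation (zdGraph d) p).real (E ∩
        {ω : BondConfig (Site d) | ∀ t ∈ innerBoundary (zdGraph d) (box d a), ∀ s ∈ innerBoundary (zdGraph d) (box d (l * a)),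
        ∀ t' ∈ innerBoundary (zdGraph d) (box d a), ∀ s' ∈ innerBoundary (zdGraph d) (box d (l * a)),
        ω ∈ openConnIn (↑((box d (l * a) \ box d a) ∪ innerBoundary (zdGraph d) (box d a)) : Set (Site d)) t s →
        ω ∈ openConnIn (↑((box d (l * a) \ box d a) ∪ innerBoundary (zdGraph d) (box d a)) : Set (Site d)) t' s' →
        ω ∈ openConnIn (↑((box d (l * a) \ box d a) ∪ innerBoundary (zdGraph d) (box d a)) : Set (Site d)) s s'}))
    (a : ℕ → ℕ) (ha1 : ∀ i, 1 ≤ a i) (hnest : ∀ i, l * a i + 1 ≤ a (i + 1))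
    {ν : Measure (BondConfig (Site d))} [IsProbabilityMeasure ν]
    (hν : ∀ (F : Finset (Sym2 (Site d))) (E : Set (BondConfig (Site d))), MeasurableSet E → DeterminedBy E ↑F →
      Tendsto (fun n : ℕ => (bondPercolation (zdGraph d) p).real (E ∩ siteToBoundary d n) / oneArmProb d p n)
        atTop (𝓝 (ν.real E))) {δ : ℝ} (hδ0 : 0 ≤ δ) (hδ : δ < c) :
    ∀ᵐ ω ∂ν, ∀ᶠ k : ℕ in atTop, δ * (k : ℝ) < (((∑ i ∈ Finset.range k, ({ω : BondConfig (Site d) | ∀ t ∈ innerBoundary (zdGraph d) (box d (a i)), ∀ s ∈ innerBoundary (zdGraph d) (box d (l * a i)),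
        ∀ t' ∈ innerBoundary (zdGraph d) (box d (a i)), ∀ s' ∈ innerBoundary (zdGraph d) (box d (l * a i)),
        ω ∈ openConnIn (↑((box d (l * a i) \ box d (a i)) ∪ innerBoundary (zdGraph d) (box d (a i))) : Set (Site d)) t s →
        ω ∈ openConnIn (↑((box d (l * a i) \ box d (a i)) ∪ innerBoundary (zdGraph d) (box d (a i))) : Set (Site d)) t' s' →
        ω ∈ openConnIn (↑((box d (l * a i) \ box d (a i)) ∪ innerBoundary (zdGraph d) (box d (a i))) : Set (Site d)) s s'} : Set (BondConfig (Site d))).indicator (fun _ => (1 : ℕ)) ω) : ℕ) : ℝ) := by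
  have hc : 0 < c := lt_of_le_of_lt hδ0 hδ
  have hc1 : c ≤ 1 := by
    have h := hCU 1 le_rfl Set.univ isUpperSet_univ MeasurableSet.univ
    rw [probReal_univ, mul_one, Set.univ_inter] at h
    exact h.trans measureReal_le_one
  -- the weight `t` and the rate `ρ`
  set t : ℝ := (1 + δ / c) / 2 with ht
  have hδc : δ / c < 1 := (div_lt_one hc).2 hδ
  have hδc0 : 0 ≤ δ / c := div_nonneg hδ0 hc.le
  have ht0 : 0 < t := by rw [ht]; linarith
  have ht1 : t < 1 := by rw [ht]; linarith
  have htδ : δ < t * c := by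
    have : δ = δ / c * c := by field_simp
    rw [this, ht]; nlinarith
  set ρ : ℝ := t⁻¹ ^ δ * (1 - (1 - t) * c) with hρ
  have hq0 : 0 < 1 - (1 - t) * c := by nlinarith
  have hρ0 : 0 ≤ ρ := mul_nonneg (Real.rpow_nonneg (inv_pos.2 ht0).le _) hq0.le
  have hρ1 : ρ < 1 := by
    -- `log ρ ≤ δ (1/t − 1) + (−(1−t)c) = (1−t)(δ/t − c) < 0`
    have hlog1 : Real.log (t⁻¹ ^ δ) ≤ δ * (t⁻¹ - 1) := by
      rw [Real.log_rpow (inv_pos.2 ht0)]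
      exact mul_le_mul_of_nonneg_left (Real.log_le_sub_one_of_pos (inv_pos.2 ht0)) hδ0
    have hlog2 : Real.log (1 - (1 - t) * c) ≤ -((1 - t) * c) := by
      have := Real.log_le_sub_one_of_pos hq0; linarith
    have hneg : δ * (t⁻¹ - 1) + -((1 - t) * c) < 0 := by
      have h1 : δ * (t⁻¹ - 1) = (1 - t) * (δ / t) := by field_simp
      rw [h1]
      have h2 : δ / t < c := (div_lt_iff₀ ht0).2 (by linarith [htδ, mul_comm t c])
      nlinarith
    have hρpos : 0 < ρ := mul_pos (Real.rpow_pos_of_pos (inv_pos.2 ht0) _) hq0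
    have hlogρ : Real.log ρ < 0 := by
      rw [hρ, Real.log_mul (Real.rpow_pos_of_pos (inv_pos.2 ht0) _).ne' hq0.ne']
      linarith
    exact (Real.log_neg_iff hρpos).1 hlogρ
  set S : ℕ → Set (BondConfig (Site d)) := fun k => {ω | (∑ i ∈ Finset.range k, ({ω : BondConfig (Site d) | ∀ t ∈ innerBoundary (zdGraph d) (box d (a i)), ∀ s ∈ innerBoundary (zdGraph d) (box d (l * a i)),
        ∀ t' ∈ innerBoundary (zdGraph d) (box d (a i)), ∀ s' ∈ innerBoundary (zdGraph d) (box d (l * a i)),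
        ω ∈ openConnIn (↑((box d (l * a i) \ box d (a i)) ∪ innerBoundary (zdGraph d) (box d (a i))) : Set (Site d)) t s →
        ω ∈ openConnIn (↑((box d (l * a i) \ box d (a i)) ∪ innerBoundary (zdGraph d) (box d (a i))) : Set (Site d)) t' s' →
        ω ∈ openConnIn (↑((box d (l * a i) \ box d (a i)) ∪ innerBoundary (zdGraph d) (box d (a i))) : Set (Site d)) s s'} : Set (BondConfig (Site d))).indicator (fun _ => (1 : ℕ)) ω) ≤ ⌊δ * (k : ℝ)⌋₊} with hS
  have hle : ∀ k, ν (S k) ≤ ENNReal.ofReal (ρ ^ k) := fun k => by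
    rw [← ENNReal.ofReal_toReal (measure_ne_top ν (S k))]
    refine ENNReal.ofReal_le_ofReal ?_
    have h1 := iicMeasure_real_count_annulusUniq_le_of_weight p hl hCU a ha1 hnest hν ht0 ht1.le k ⌊δ * (k : ℝ)⌋₊
    have hti : 1 ≤ t⁻¹ := (one_le_inv₀ ht0).2 ht1.le
    have h2 : t⁻¹ ^ ⌊δ * (k : ℝ)⌋₊ ≤ (t⁻¹ ^ δ) ^ k := by
      rw [← Real.rpow_natCast, ← Real.rpow_mul_natCast (inv_pos.2 ht0).le]
      exact Real.rpow_le_rpow_of_exponent_le hti (Nat.floor_le (by positivity))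
    calc (ν (S k)).toReal = ν.real (S k) := rfl
      _ ≤ t⁻¹ ^ ⌊δ * (k : ℝ)⌋₊ * (1 - (1 - t) * c) ^ k := h1
      _ ≤ (t⁻¹ ^ δ) ^ k * (1 - (1 - t) * c) ^ k := mul_le_mul_of_nonneg_right h2 (pow_nonneg hq0.le k)
      _ = ρ ^ k := by rw [hρ, mul_pow]
  have hsum : (∑' k, ν (S k)) ≠ ⊤ := by
    have hgeom : Summable fun k : ℕ => ρ ^ k := summable_geometric_of_lt_one hρ0 hρ1
    have hfin : (∑' k, ENNReal.ofReal (ρ ^ k)) ≠ ⊤ := by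
      rw [← ENNReal.ofReal_tsum_of_nonneg (fun k => pow_nonneg hρ0 k) hgeom]
      exact ENNReal.ofReal_ne_top
    exact ne_top_of_le_ne_top hfin (ENNReal.tsum_le_tsum hle)
  filter_upwards [ae_eventually_notMem hsum] with ω hω
  refine hω.mono fun k hk => ?_
  simp only [hS, Set.mem_setOf_eq, not_le] at hk
  have := (Nat.floor_lt (by positivity)).1 hk
  exact_mod_cast this

end Summit.CriticalPhenomena.PercolationContinuityZ3.Theorems.Crossing

end
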